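import Mathlib
import Literature.Analysis.FluidPDE.InfiniteHardSphereDynamics

/-!
# Sketch — crux-ideate stmt-AtomisticToContinuum-12949 (AdaptedWeightCLT), round 1, ideator 1

First checkable statements of the three idea cards (elaboration only is required; the small
algebraic lemmas are proved). Namespace follows the crux-workfile convention.
-/

namespace Summit.AtomisticToContinuum.HydrodynamicLimit.Cruxes.AdaptedWeightCLT.IdeatorOne

open scoped BigOperators InnerProductSpace ENNReal Matrix
open Finset MeasureTheory

/-! ## Card `kinship-prices-selection`

`a k = ‖M_ik‖_F²`, `b k = ‖M_jk‖_F²` are the backward mass distributions of two rows of the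
transfer (each sums to `3`); kinship `K_ij = ∑_k a_k b_k`, `ipr_i = ∑_k a_k²`. -/

/-- AM–GM per ancestor: the kinship of two rows is at most half the sum of their inverse
participation ratios — so `E[ipr] → 0` along the colliding population kills mean kinship. -/
theorem kinship_le_half_iprs {n : ℕ} (a b : Fin n → ℝ) :
    ∑ k, a k * b k ≤ ((∑ k, a k ^ 2) + ∑ k, b k ^ 2) / 2 := by
  have h : ∀ k, a k * b k ≤ (a k ^ 2 + b k ^ 2) / 2 := fun k => by
    nlinarith [sq_nonneg (a k - b k)]
  calc ∑ k, a k * b k ≤ ∑ k, (a k ^ 2 + b k ^ 2) / 2 := Finset.sum_le_sum fun k _ => h k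
    _ = ((∑ k, a k ^ 2) + ∑ k, b k ^ 2) / 2 := by
        rw [← Finset.sum_div, Finset.sum_add_distrib]

/-- Cauchy–Schwarz form `K_ij² ≤ ipr_i · ipr_j` (the sibling triage's kinship bound). -/
theorem kinship_sq_le_ipr_mul_ipr {n : ℕ} (a b : Fin n → ℝ) :
    (∑ k, a k * b k) ^ 2 ≤ (∑ k, a k ^ 2) * ∑ k, b k ^ 2 :=
  Finset.sum_mul_sq_le_sq_mul_sq _ a b

/-- Typed schema of LEMMA K (card 2): an abstract "pre-collisional dependence is priced by
shared backward mass". `dep i j` = any bounded dependence functional of the pre-collisional pair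
(e.g. a bounded-Lipschitz distance of the pair law from the flux-biased product), `K i j` its
kinship, `D` the current local anisotropy amplitude, `osc` the oscillation of the local fields
over the rows' supports; `Cσ` carries the `O(σ³)` ring coefficient. -/
def CorrelationPricedByKinship {n : ℕ} (dep K : Fin n → Fin n → ℝ) (D osc C Cσ : ℝ) : Prop :=
  ∀ i j, i ≠ j → |dep i j| ≤ C * K i j + Cσ * D + osc

/-! ## Card `moment-transport-isotropy-parity`

One specular collision with unit normal `ω`: `v' = v - a ω`, `w' = w + a ω`, `a = ⟪v - w, ω⟫`.
The tested pair second moment changes by an explicit quadratic expression in `(a, ⟪ω,e⟫,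
⟪v - w, e⟫)` — the only source of change of the kinetic stress tensor along the deterministic
flow (free flight does not move velocities). -/

/-- Exact increment of the `e ⊗ e`-tested pair second moment at one collision. -/
theorem pair_second_moment_increment (v w ω e : EuclideanSpace ℝ (Fin 3)) (a : ℝ) :
    ⟪v - a • ω, e⟫_ℝ ^ 2 + ⟪w + a • ω, e⟫_ℝ ^ 2 - ⟪v, e⟫_ℝ ^ 2 - ⟪w, e⟫_ℝ ^ 2
      = -(2 * a * ⟪ω, e⟫_ℝ * ⟪v - w, e⟫_ℝ) + 2 * a ^ 2 * ⟪ω, e⟫_ℝ ^ 2 := by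
  simp only [inner_sub_left, inner_add_left, real_inner_smul_left]
  ring

/-- Energy (trace) is exactly conserved at the collision when `‖ω‖ = 1` and `a = ⟪v - w, ω⟫`. -/
theorem pair_energy_conserved (v w ω : EuclideanSpace ℝ (Fin 3)) (hω : ‖ω‖ = 1) :
    let a : ℝ := ⟪v - w, ω⟫_ℝ
    ‖v - a • ω‖ ^ 2 + ‖w + a • ω‖ ^ 2 = ‖v‖ ^ 2 + ‖w‖ ^ 2 := by
  intro a
  have ha : a = ⟪v, ω⟫_ℝ - ⟪w, ω⟫_ℝ := by simp [a, inner_sub_left]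
  rw [norm_sub_sq_real, norm_add_sq_real, norm_smul, real_inner_smul_right,
    real_inner_smul_right, Real.norm_eq_abs, hω, mul_one, sq_abs]
  rw [ha]
  ring

/-- Scalar shadow of the INTERFERENCE TRACE IDENTITY: if the columns of a transfer are
orthonormal (`∑_i M_ik M_il = δ_kl`), the off-diagonal ("interference") part of the transported
quadratic form has zero total: `∑_i ∑_{k ≠ l} c_k M_ik M_il c_l = 0`. (Block `3 × 3` version:
`∑_i ∑_{k≠l} c_kᵀ M_ikᵀ M_il c_l = 0`; same proof with `Matrix`.) -/
theorem interference_trace_vanishes_scalar {n : ℕ} (M : Fin n → Fin n → ℝ)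
    (hM : ∀ k l, ∑ i, M i k * M i l = if k = l then 1 else 0) (c : Fin n → ℝ) :
    ∑ i, ∑ k, ∑ l, (if k = l then 0 else c k * M i k * M i l * c l) = 0 := by
  have key : ∀ k l, ∑ i, (if k = l then 0 else c k * M i k * M i l * c l) = 0 := by
    intro k l
    by_cases hkl : k = l
    · simp [hkl]
    · have h0 : ∑ i, M i k * M i l = 0 := by simpa [hkl] using hM k l
      have : ∑ i, c k * M i k * M i l * c l = c k * c l * ∑ i, M i k * M i l := by
        rw [Finset.mul_sum]; refine Finset.sum_congr rfl fun i _ => by ring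
      simp [hkl, this, h0]
  rw [Finset.sum_comm]
  refine Finset.sum_eq_zero fun k _ => ?_
  rw [Finset.sum_comm]
  exact Finset.sum_eq_zero fun l _ => key k l

/-- Typed stub (card 1, abstract over a block transfer `M`): ROTATIONAL CONTRACTION of row `i`
with factor `κ` — the transported traceless stress `∑_k M_ik C M_ikᵀ` of every unit traceless
symmetric `C` has Frobenius norm at most `κ` (the refuter's `RotationalDiffuseness`, made a
contraction constant). -/
def RowRotationalContraction {n : ℕ} (M : Fin n → Fin n → Matrix (Fin 3) (Fin 3) ℝ)
    (i : Fin n) (κ : ℝ) : Prop :=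
  ∀ C : Matrix (Fin 3) (Fin 3) ℝ, C.IsSymm → C.trace = 0 → (∑ j, ∑ k, C j k ^ 2) = 1 →
    (∑ j, ∑ k, ((∑ l, M i l * C * (M i l)ᵀ) j k) ^ 2) ≤ κ ^ 2

/-- Typed stub (card 1): ANCESTOR INCOHERENCE of a block `B` of rows at tolerance `η` for the
input field `c` — the block-averaged interference tensor `∑_{i∈B} ∑_{k≠l} M_ik c_k c_lᵀ M_ilᵀ`
is `η`-small entrywise relative to the block size. -/
def BlockAncestorIncoherence {n : ℕ} (M : Fin n → Fin n → Matrix (Fin 3) (Fin 3) ℝ)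
    (B : Finset (Fin n)) (c : Fin n → Fin 3 → ℝ) (η : ℝ) : Prop :=
  ∀ j j' : Fin 3,
    |∑ i ∈ B, ∑ k, ∑ l, (if k = l then 0 else
        ((M i k).mulVec (c k)) j * ((M i l).mulVec (c l)) j')| ≤ η * B.card

/-! ## Card `diffuse-stationary-rigidity`

The limit object: a translation-invariant stationary law of an infinite hard-sphere flow
(tree: `InfiniteHardSphereFlow`, `IsTranslationInvariant`, `intensity`, `kineticEnergyDensity`).
The diffuse-influence property of the limit law is an explicit PARAMETER `DI` here (the infinite
flow's velocity transfer is not yet a tree definition); LEMMA R says: such laws have an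
isotropic, parity-symmetric one-particle velocity law (scalar second moment, zero third moment
in the unit cube) — exactly what the Euler closure of the kinetic fluxes consumes. -/

open Literature.Analysis.FluidPDE Literature.Analysis.FunctionSpaces in
/-- LEMMA R schema (card 3). -/
def DiffuseInfluenceRigidity
    (DI : ∀ {ε : ℝ}, InfiniteHardSphereFlow (Fin 3) ε →
      Measure (PointConfig (EuclideanSpace ℝ (Fin 3) × EuclideanSpace ℝ (Fin 3))) → Prop) :
    Prop :=
  ∀ (ε : ℝ), 0 < ε → ∀ (Φ : InfiniteHardSphereFlow (Fin 3) ε)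
    (ν : Measure (PointConfig (EuclideanSpace ℝ (Fin 3) × EuclideanSpace ℝ (Fin 3)))),
    IsProbabilityMeasure ν → IsTranslationInvariant ν → Φ.IsAEDefined ν → Φ.IsStationary ν →
    intensity ν < ∞ → kineticEnergyDensity ν < ∞ → DI Φ ν →
    ∃ (u : EuclideanSpace ℝ (Fin 3)) (p : ℝ),
      (∀ j k : Fin 3,
        ∫ ω, windowSumReal ω (Torus.unitCube (Fin 3))
            (fun q => (q.2 j - u j) * (q.2 k - u k)) ∂ν = if j = k then p else 0) ∧
      (∀ j : Fin 3,
        ∫ ω, windowSumReal ω (Torus.unitCube (Fin 3))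
            (fun q => ‖q.2 - u‖ ^ 2 * (q.2 j - u j)) ∂ν = 0)

end Summit.AtomisticToContinuum.HydrodynamicLimit.Cruxes.AdaptedWeightCLT.IdeatorOne
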